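import Summits.QuantumFields.YangMills.Theorems.BalabanUVNodesN11FirstStepSupply
import Summits.QuantumFields.YangMills.Theorems.BalabanUVNodesN11Sect3SupplySpliceLabels
import Literature.MathematicalPhysics.QuantumFieldTheory.Balaban1983to89.Node00.StepWeightsAtNoExpansion

/-!
# DAG node N11 — [III] §3's SUPPLY AT LEVEL `0` IN PRINT's OWN INDEXING: `FirstStepSupplyAtLabels θ p` — the first-step terms and the transport identity at
# every first-step LARGE-FIELD DECOMPOSITION `(P, Q, R, S)₁` (the label of [III] (3.2)–(3.5), (3.16), (3.20)) with non-empty small-field region `Ω₁(P, Q)`; and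
# `Sect3SupplyAt θ p 0 ↔ FirstStepSupplyAtLabels θ p` (generic `θ : Stage13HParams`, given `0 ≤ E₀, B₀`)

HEADER — WORK-UNIT METADATA.  Cell `pub-ymgap`, YM-PLAN Track A (HUMAN RULING D-0062 ∕ D-0149 width push), seat `pub-ymgap-dag-n08-w2` (g0; WIDTH SEAT re-pointed by the
dag-lead desk to N11's §3-supply residue, DEDUP-354∕355; dag-n11-e g15's hand-out «X3», INBOX 2026-08-28T00:23:43Z), route `BalabanUVNodes` rev 25 (v1.7 `CoPH` key), item
K1⁷ `StabilityBAtRecordR13SepCoPH` = stmt-QuantumFields-20542; DEFINITION lane (`--supports 20542 --as helper`), count-neutral.  [III] = [Balaban1988Convergent],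
[I] = [Balaban1987RG1], [II] = [Balaban1988RG2Cluster].  Over this seat's `…N11FirstStepSupply` (p586913 ∕ p588912: `FirstStepSupplyAt`, `FirstStepIntegralIdentityAt`,
`slotsTOfRecord₁₃H_one_eq`, `sect2Slot_graftAbove_zero`, `sect2Slot_eq_TkOfRecord_sect2Operand`), dag-n11-e's `…N11Sect3SupplySpliceLabels` (p588617:
`sect3SupplyAt_of_spliceSupply_at_labels`), NODE 00's `StepWeightsOfRecord` (the label type `LbOfRecord`, the index map `σOfRecord s₀ t` of (3.5)∕(3.20) with
`Ω_{k+1}(t) = OmegaOfLabel`, `Λ_{k+1}(t) = LambdaOfLabel`) and K0b's `StepWeightsAtNoExpansion` (the layer algebra at `k = 0`: `W32_zero`).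

WHY THIS FILE.  `FirstStepSupplyAt` ∕ `FirstStepIntegralIdentityAt` (this seat) quantify over the HISTORIES `s = (Ω₁, Λ₁)` of length 1; print indexes the first-step terms by the
LABEL `t = (P₁, Q₁, R₁, S₁)` of the decompositions (3.2), (3.3), (3.16), (3.20)∕(3.21), whose regions `Ω₁(t)`, `Λ₁(t)` are NODE 00's `OmegaOfLabel ∕ LambdaOfLabel` ((3.5) ∕ (3.20)
at the unique length-0 history `s₀`).  By dag-n11-e's `sect3SupplyAt_of_spliceSupply_at_labels` the supply is owed only at the labelled children `σOfRecord s₀ t` whose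
small-field region is non-empty and whose 𝐓-slot is present — at `k = 0`: (O1) void, no witness read (this seat's §1), the parent always present.  HENCE the level-0 supply
in print's indexing reads: «ONE family of first-step term values `u` (universal in `𝐄^{(1)}`) and constants `E₁` such that for EVERY first-step label `t` with `Ω₁(t) ≠ ∅` whose
transported weighted start `V′ ↦ 𝐓[w₀(σ s₀ t)·ρ₀](V′)` is not identically zero: r11's new-term clauses + analyticity at level 1 for `u (σ s₀ t)`, and
`𝐓[w₀(σ s₀ t)·ρ₀](V′) = 𝐓₁(σ s₀ t)[W] (exp A₁(σ s₀ t)[u, E₁]) (V′)` for `dV′`-a.e. `V′` on the support of `χ₁(σ s₀ t)`» — and this is EQUIVALENT to `Sect3SupplyAt θ p 0`.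

WHAT THIS FILE PROVES (1 `def … : Prop` naming the deliverable in print's indexing — NOT claimed inhabited; theorems otherwise; 0 `sorry`, standard axioms).
§1 `seqOfRecord_zero_eq` (the length-0 history is UNIQUE: `Ω = Λ = ∅` off the empty window) · `lamPrevZero_eq_univ`, `guardΩ_zero`, `omegaOfLabel_zero_eq` (the regions of the first step:
   no `Λ₀`-window, no large-field window `Z̃₀^{∼4}` (K0b's `W32_zero`) — `Ω₁(t) = fillD(Ω⁰(P,Q) ∖ ∪P)`, `(σ s₀ t).Ω 1 = Ω₁(t)`, `(σ s₀ t).Λ 1 = Λ₁(t)`).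
§2 `def FirstStepSupplyAtLabels θ p : Prop`.
§3 `firstStepSupplyAtLabels_of_firstStepSupplyAt` (restriction to the labelled pairs; the presence guard kills the zero disjunct) · ★ `sect3SupplyAt_zero_of_firstStepSupplyAtLabels`
   (`0 ≤ E₀, B₀`; dag-n11-e's labels theorem at `k = 0`, `tnew := u`, (O3) by this seat's `slotsTOfRecord₁₃H_one_eq` + `sect2Slot_graftAbove_zero`) ·
   `firstStepSupplyAtLabels_of_sect3SupplyAt_zero` (the converse: instantiate at the exposed witness of `ρ₀` from def-T's `sLaw₁₃CoPH_zero`; `u :=` the supplied family; the laws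
   `Sect2.LawsT … 0` contain r11's new-term clauses and `LFHypAnalytic … 1`) · ★★ `sect3SupplyAt_zero_iff_firstStepSupplyAtLabels`.
§4 ★ `sLaw₁₃CoPH_one_rePinH_doorCured_theta13LiveOfRecord_of_firstStepSupplyAtLabels` (`0 < K` + the labelled first-step supply ALONE ⇒ `ρ₁`'s §2 form at the re-pinned door of
   the cured witness of record; dag-n11-e M2 §6 over §3).

HONEST FRAMING.  Count-neutral kernel bookkeeping + ONE definition (the same level-0 deliverable, third currency: print's labels); `FirstStepSupplyAtLabels` = [I] Thm 1 + [II] at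
def-T's level-1 objects, NOT proved for any `θ` (NODE-00-sized one-carrier instantiation); nothing of Bałaban asserted; N11 NOT discharged; K1⁷ NOT closed; counts unmoved
(typed 28∕28 · discharged 5∕27).  One finite `𝕋⁴_{L^K}` programme at fixed `ε = L^{−K}`; R4 closes only the conditional finite-𝕋⁴ rung `BalabanLadder.UV` — NOT ℝ⁴, NOT OS,
NOT a mass gap, NOT Clay.  No `sorry`, no `axiom`, no `instance`, no `notation`.
Sources: [III] Thm 1 p.262, Thm 2 p.263, §3 pp.264–270, (3.1)–(3.5) pp.264–265, (3.16) p.268, (3.20)–(3.21) p.269, (3.24)–(3.25) p.270, (2.1) p.254, (2.18) p.257, (2.23) p.258,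
(2.27)–(2.31) pp.259–260, (2.41)–(2.42) p.261; [I] Thm 1 p.258.
-/

noncomputable section

open MeasureTheory
open scoped BigOperators Matrix.Norms.L2Operator

namespace Summit.QuantumFields.YangMills.Theorems.BalabanUVNodesN11FirstStepSupplyLabels

open Literature.MathematicalPhysics.QuantumFieldTheory.Balaban1983to89 T4Continuum Node00 Node00.Tk
open Step B14.Eq227LocalizedTerms
open BalabanUVNodesN11Sect3SupplyDefs (Sect3SupplyAt)
open BalabanUVNodesN11Sect3SupplySpliceDefs
open BalabanUVNodesN11Sect3SupplySpliceLabels (sect3SupplyAt_of_spliceSupply_at_labels)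
open BalabanUVNodesN11FirstStepSupply
open BalabanUVNodesN11ThmP245OfSect3SupplyCoPH (sLaw₁₃CoPH_one_rePinH_doorCured_theta13LiveOfRecord_of_sect3Supply_zero)
open BalabanUVNodesN11RePinnedParamDefs (rePinH)
open Literature.MathematicalPhysics.QuantumFieldTheory.Balaban1983to89.B16RLeafRecord13AtLive (B0_nonneg_theta13LiveOfFamily E0_nonneg_theta13LiveOfFamily)

/-! ## §1. The length-0 history is unique; the regions of the first step -/

section Regions

variable {F : T4Family} {ν : Stage7Numerics} {M : ℕ} {g : ℕ → ℝ} {K : ℕ} (p : B12.RunParams)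

/-- **THE LENGTH-0 HISTORY IS UNIQUE**: a (2.18) index of length `0` has `Ω_j = Λ_j = ∅` at every `j` (r11's off-window normalisation `Seq.Ω_off ∕ Λ_off` with an
empty window), so any two coincide (`Seq.ext'`) — the «one-term representation of `ρ₀`». [cite: Balaban1988Convergent, (2.18) p.257, (2.1) p.254, Thm 1 p.262 (bookkeeping)] -/
theorem seqOfRecord_zero_eq (s s' : SeqOfRecord F ν M g K 0) : s = s' := by
  refine B14.Eq218Concrete.Seq.ext' ?_ ?_
  · funext j
    rw [s.Ω_off j (fun h => Nat.not_succ_le_zero 0 (h.1.trans h.2)), s'.Ω_off j (fun h => Nat.not_succ_le_zero 0 (h.1.trans h.2))]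
  · funext j
    rw [s.Λ_off j (fun h => Nat.not_succ_le_zero 0 (h.1.trans h.2)), s'.Λ_off j (fun h => Nat.not_succ_le_zero 0 (h.1.trans h.2))]

/-- **NO `Λ₀`-WINDOW AT THE FIRST STEP**: NODE 00's admissibility window `LamPrev` ((2.1) `Ω_{k+1} ⊂ Λ_k`) is the whole torus at `k = 0`. [cite: Balaban1988Convergent, (2.1) p.254 (bookkeeping)] -/
theorem lamPrevZero_eq_univ (s₀ : SeqOfRecord F ν M g p.K 0) : LamPrev F ν M p g 0 s₀ = Set.univ := by
  simp [LamPrev]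

/-- **THE (3.5) TYPING GUARD AT THE FIRST STEP IS `(∪P₁)ᶜ`**: no `Λ₀`-window and no large-field window `Z̃₀^{∼4}` (K0b's `W32_zero`). [cite: Balaban1988Convergent, (3.2) p.265, (3.5) p.265 (bookkeeping)] -/
theorem guardΩ_zero (s₀ : SeqOfRecord F ν M g p.K 0) (Pl : Finset (Iχ F ν p g 0)) :
    guardΩ F ν M p g 0 s₀ Pl = (cubesχ F ν p g 0 Pl)ᶜ := by
  rw [guardΩ, lamPrevZero_eq_univ, W32_zero, Set.univ_inter, Set.univ_inter]

/-- **`Ω₁(t)` AT THE FIRST STEP**: the (3.5) region `Ω⁰(P₁, Q₁)` outside the large cubes `∪P₁`, filled with 𝐃₁-cubes — no other window. [cite: Balaban1988Convergent, (3.5) p.265] -/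
theorem omegaOfLabel_zero_eq (s₀ : SeqOfRecord F ν M g p.K 0) (t : LbOfRecord F ν p g 0) :
    OmegaOfLabel F ν M p g 0 s₀ t = fillD (F.P p.K) (sideD F ν M p g 0) (Omega0 F ν M p g 0 s₀ t.1 t.2.1 ∩ (cubesχ F ν p g 0 t.1)ᶜ) := by
  rw [OmegaOfLabel, guardΩ_zero]

/-- The labelled first-step history has small-field region `Ω₁ = Ω₁(t)` (NODE 00's `σOfRecord_Ω_succ` at `k = 0`). [cite: Balaban1988Convergent, (3.5) p.265 (bookkeeping)] -/
theorem σOfRecord_zero_Ω_one (s₀ : SeqOfRecord F ν M g p.K 0) (t : LbOfRecord F ν p g 0) :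
    (σOfRecord F ν M p g 0 s₀ t).Ω 1 = OmegaOfLabel F ν M p g 0 s₀ t :=
  σOfRecord_Ω_succ F ν M p g 0 s₀ t

/-- … and `Λ₁ = Λ₁(t)` ((3.20) at `k = 0`). [cite: Balaban1988Convergent, (3.20) p.269 (bookkeeping)] -/
theorem σOfRecord_zero_Λ_one (s₀ : SeqOfRecord F ν M g p.K 0) (t : LbOfRecord F ν p g 0) :
    (σOfRecord F ν M p g 0 s₀ t).Λ 1 = LambdaOfLabel F ν M p g 0 s₀ t :=
  σOfRecord_Λ_succ F ν M p g 0 s₀ t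

end Regions

/-! ## §2. The first-step supply in print's indexing -/

section Labels

variable {F : T4Family} {N : ℕ} [NeZero N]

/-- **THE FIRST-STEP SUPPLY IN PRINT's INDEXING** at the v1.7 parameter `θ` for the run `p`: first-step term values `u s` (universal in `𝐄^{(1)}`) and constants `E₁ s`
such that for EVERY (unique) length-0 history `s₀` and EVERY first-step label `t = (P₁, Q₁, R₁, S₁)` ([III] (3.2), (3.3), (3.16), (3.20)∕(3.21)) with NON-EMPTY small-field
region `Ω₁(t) = OmegaOfLabel … 0 s₀ t` and whose transported weighted start `V′ ↦ transportOfRecord F N K 0 (U ↦ w₀(σ s₀ t)(U,V′)·ρ₀(U)) V′` is NOT identically zero,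
at the labelled child `s = σOfRecord … 0 s₀ t = (Ω₁(t); Λ₁(t))`: (i) r11's new-term obligations `Step.LFNewTerms … 0` for `u s`; (ii) analyticity of `𝐄^{(1)} ∕ 𝐑^{(1)} ∕ 𝐁^{(1)}`
at level 1; (iii) THE FIRST-STEP TRANSPORT IDENTITY `transportOfRecord F N K 0 (U ↦ w₀(s)(U,V′)·ρ₀(U)) V′ = 𝐓₁(s)[W(s)] (exp A₁(s)[u s, E₁ s]) V′` for `dV′`-a.e. `V′` on the support
of `χ₁(s)` — [I] Thm 1 + [II] at def-T's level-1 objects, indexed as in print.  A predicate naming a deliverable — NOT claimed for any `θ`.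
[cite: Balaban1988Convergent, §3 pp.264–270, (3.2)–(3.5) p.265, (3.20) p.269, (3.24)–(3.25) p.270, Thm 2 p.263; Balaban1987RG1, Thm 1 p.258] -/
def FirstStepSupplyAtLabels (θ : Stage13HParams F N) (p : B12.RunParams) : Prop :=
  ∃ (u : SeqOfRecord F θ.ν θ.τ9.M (gOfRecord₁₃ F N θ.toStage13Params p) p.K 1 → Sect2.TermValues (F.P p.K) (MatA N) (FluctV N) θ.τ9.M)
    (E₁ : SeqOfRecord F θ.ν θ.τ9.M (gOfRecord₁₃ F N θ.toStage13Params p) p.K 1 → ℝ),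
    Sect2.UniversalE u ∧
    ∀ (s₀ : SeqOfRecord F θ.ν θ.τ9.M (gOfRecord₁₃ F N θ.toStage13Params p) p.K 0) (t : LbOfRecord F θ.ν p (gOfRecord₁₃ F N θ.toStage13Params p) 0),
      OmegaOfLabel F θ.ν θ.τ9.M p (gOfRecord₁₃ F N θ.toStage13Params p) 0 s₀ t ≠ ∅ →
      (fun V' : GaugeField (F.P p.K) 1 (SU N) =>
          transportOfRecord F N p.K 0 (fun U =>
            wOfRecord₉ F N θ.toStage9Params p (gOfRecord₁₃ F N θ.toStage13Params p) 0 (σOfRecord F θ.ν θ.τ9.M p (gOfRecord₁₃ F N θ.toStage13Params p) 0 s₀ t) U V' *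
              rhoZeroOfRecord F N p.K (gOfRecord₁₃ F N θ.toStage13Params p 0) (EOfRecord₁₃ F N θ.toStage13Params p) U) V') ≠ 0 →
      Step.LFNewTerms (sect2TowerOfRecord F N (FluctV N) p.K (settingOfRecord₁₃ F N θ.toStage13Params p)
          (θ.rzAt p (σOfRecord F θ.ν θ.τ9.M p (gOfRecord₁₃ F N θ.toStage13Params p) 0 s₀ t)) (σOfRecord F θ.ν θ.τ9.M p (gOfRecord₁₃ F N θ.toStage13Params p) 0 s₀ t)
          (u (σOfRecord F θ.ν θ.τ9.M p (gOfRecord₁₃ F N θ.toStage13Params p) 0 s₀ t)))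
        (settingOfRecord₁₃ F N θ.toStage13Params p).lf (settingOfRecord₁₃ F N θ.toStage13Params p).βc 0 ∧
      (∀ (X : (Sect2.domSys (F.P p.K) θ.τ9.M 1).Dom) (z : Site (F.P p.K) 1) (g : ℝ), 0 ≤ g → g ≤ (settingOfRecord₁₃ F N θ.toStage13Params p).lf.γ →
        AnalyticOnNhd ℂ ((u (σOfRecord F θ.ν θ.τ9.M p (gOfRecord₁₃ F N θ.toStage13Params p) 0 s₀ t)).E 1 X z g)
          ((sect2TowerOfRecord F N (FluctV N) p.K (settingOfRecord₁₃ F N θ.toStage13Params p)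
            (θ.rzAt p (σOfRecord F θ.ν θ.τ9.M p (gOfRecord₁₃ F N θ.toStage13Params p) 0 s₀ t)) (σOfRecord F θ.ν θ.τ9.M p (gOfRecord₁₃ F N θ.toStage13Params p) 0 s₀ t)
            (u (σOfRecord F θ.ν θ.τ9.M p (gOfRecord₁₃ F N θ.toStage13Params p) 0 s₀ t))).space 1 X
            ((settingOfRecord₁₃ F N θ.toStage13Params p).lf.alpha0 ((settingOfRecord₁₃ F N θ.toStage13Params p).flow.g 1))
            ((settingOfRecord₁₃ F N θ.toStage13Params p).lf.alpha1 ((settingOfRecord₁₃ F N θ.toStage13Params p).flow.g 1)))) ∧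
      (∀ X : (Sect2.domSys (F.P p.K) θ.τ9.M 1).Dom,
        AnalyticOnNhd ℂ ((u (σOfRecord F θ.ν θ.τ9.M p (gOfRecord₁₃ F N θ.toStage13Params p) 0 s₀ t)).R 1 X)
          ((sect2TowerOfRecord F N (FluctV N) p.K (settingOfRecord₁₃ F N θ.toStage13Params p)
            (θ.rzAt p (σOfRecord F θ.ν θ.τ9.M p (gOfRecord₁₃ F N θ.toStage13Params p) 0 s₀ t)) (σOfRecord F θ.ν θ.τ9.M p (gOfRecord₁₃ F N θ.toStage13Params p) 0 s₀ t)
            (u (σOfRecord F θ.ν θ.τ9.M p (gOfRecord₁₃ F N θ.toStage13Params p) 0 s₀ t))).space 1 X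
            ((settingOfRecord₁₃ F N θ.toStage13Params p).lf.alpha0 ((settingOfRecord₁₃ F N θ.toStage13Params p).flow.g 1))
            ((settingOfRecord₁₃ F N θ.toStage13Params p).lf.alpha1 ((settingOfRecord₁₃ F N θ.toStage13Params p).flow.g 1)))) ∧
      (∀ (X : (Sect2.domSys (F.P p.K) θ.τ9.M 1).Dom) (a : SFluct (F.P p.K) (FluctV N)),
        AnalyticOnNhd ℂ (fun φ => (u (σOfRecord F θ.ν θ.τ9.M p (gOfRecord₁₃ F N θ.toStage13Params p) 0 s₀ t)).B 1 X φ a)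
          ((sect2TowerOfRecord F N (FluctV N) p.K (settingOfRecord₁₃ F N θ.toStage13Params p)
            (θ.rzAt p (σOfRecord F θ.ν θ.τ9.M p (gOfRecord₁₃ F N θ.toStage13Params p) 0 s₀ t)) (σOfRecord F θ.ν θ.τ9.M p (gOfRecord₁₃ F N θ.toStage13Params p) 0 s₀ t)
            (u (σOfRecord F θ.ν θ.τ9.M p (gOfRecord₁₃ F N θ.toStage13Params p) 0 s₀ t))).spaceB 1 X)) ∧
      ∀ᵐ V' ∂fieldMeasure (F.P p.K) 1 (SU N),
        chiSeqOfRecord F N θ.ν θ.τ9.M (gOfRecord₁₃ F N θ.toStage13Params p) p.K 1 (σOfRecord F θ.ν θ.τ9.M p (gOfRecord₁₃ F N θ.toStage13Params p) 0 s₀ t) V' ≠ 0 →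
          transportOfRecord F N p.K 0 (fun U =>
              wOfRecord₉ F N θ.toStage9Params p (gOfRecord₁₃ F N θ.toStage13Params p) 0 (σOfRecord F θ.ν θ.τ9.M p (gOfRecord₁₃ F N θ.toStage13Params p) 0 s₀ t) U V' *
                rhoZeroOfRecord F N p.K (gOfRecord₁₃ F N θ.toStage13Params p 0) (EOfRecord₁₃ F N θ.toStage13Params p) U) V' =
            TkOfRecord F N (FluctV N) θ.ν θ.τ9.M (gOfRecord₁₃ F N θ.toStage13Params p) p.K
              (WtOfRecord₁₃H F N θ p (σOfRecord F θ.ν θ.τ9.M p (gOfRecord₁₃ F N θ.toStage13Params p) 0 s₀ t)) 1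
              (σOfRecord F θ.ν θ.τ9.M p (gOfRecord₁₃ F N θ.toStage13Params p) 0 s₀ t)
              (sect2Operand F N (FluctV N) p.K (settingOfRecord₁₃ F N θ.toStage13Params p)
                (θ.rzAt p (σOfRecord F θ.ν θ.τ9.M p (gOfRecord₁₃ F N θ.toStage13Params p) 0 s₀ t)) (σOfRecord F θ.ν θ.τ9.M p (gOfRecord₁₃ F N θ.toStage13Params p) 0 s₀ t)
                (u (σOfRecord F θ.ν θ.τ9.M p (gOfRecord₁₃ F N θ.toStage13Params p) 0 s₀ t)) (E₁ (σOfRecord F θ.ν θ.τ9.M p (gOfRecord₁₃ F N θ.toStage13Params p) 0 s₀ t))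
                (UbgOfRecord₁₃CoP F N θ.toStage13Params p 1 (σOfRecord F θ.ν θ.τ9.M p (gOfRecord₁₃ F N θ.toStage13Params p) 0 s₀ t))) V'

end Labels

/-! ## §3. `Sect3SupplyAt θ p 0 ↔ FirstStepSupplyAtLabels θ p` -/

section Equivalence

variable {F : T4Family} {N : ℕ} [NeZero N]
variable (θ : Stage13HParams F N) (p : B12.RunParams)

/-- **THE WITNESS-FREE FIRST-STEP SUPPLY RESTRICTS TO THE LABELLED PAIRS** (no sign needed): at a labelled child with present 𝐓-slot the zero disjunct of the integral
identity is excluded. [cite: Balaban1988Convergent, §3 p.279, (3.5) p.265, (3.25) p.270] -/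
theorem firstStepSupplyAtLabels_of_firstStepSupplyAt (h : FirstStepSupplyAt θ p) : FirstStepSupplyAtLabels θ p := by
  obtain ⟨u, E₁, hu, hx⟩ := (firstStepSupplyAt_iff_integralIdentity θ p).mp h
  refine ⟨u, E₁, hu, fun s₀ t hΩ hT => ?_⟩
  have hs : (σOfRecord F θ.ν θ.τ9.M p (gOfRecord₁₃ F N θ.toStage13Params p) 0 s₀ t).Ω 1 ≠ ∅ := by
    rw [σOfRecord_zero_Ω_one]; exact hΩ
  obtain ⟨hnew, hanE, hanR, hanB, hcl⟩ := hx _ hs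
  exact ⟨hnew, hanE, hanR, hanB, hcl.resolve_left hT⟩

/-- ★ **THE LABELLED FIRST-STEP SUPPLY GIVES [III] §3's DELIVERABLE AT LEVEL `0`** (`0 ≤ E₀, B₀`): dag-n11-e's `sect3SupplyAt_of_spliceSupply_at_labels` at `k = 0` with
`tnew := u`, `EkN := E₁` — (O1) is void, the label's non-empty small-field region is `(σ s₀ t).Ω 1 ≠ ∅`, the 𝐓-presence guard is the transported start `≠ 0`
(`slotsTOfRecord₁₃H_one_eq`), (O2) is clause (i)–(ii), and (O3) for the spliced witness `graftAbove 0 (t s₀) (u (σ s₀ t))` is the transport identity (iii)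
(`sect2Slot_graftAbove_zero`, `sect2Slot = TkOfRecord ∘ sect2Operand`). [cite: Balaban1988Convergent, §3 p.279, (3.5) p.265, (3.24)–(3.25) p.270, Thm 2 p.263; Balaban1987RG1, Thm 1 p.258] -/
theorem sect3SupplyAt_zero_of_firstStepSupplyAtLabels (hE₀ : 0 ≤ θ.s2.lf.E₀) (hB₀ : 0 ≤ θ.s2.lf.B₀) (h : FirstStepSupplyAtLabels θ p) :
    Sect3SupplyAt θ p 0 := by
  refine sect3SupplyAt_of_spliceSupply_at_labels θ p hE₀ hB₀ fun t Ek _ => ?_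
  obtain ⟨u, E₁, hu, hx⟩ := h
  refine ⟨u, E₁, hu, fun s₀ lab hΩ hT => ?_⟩
  have hΩ' : OmegaOfLabel F θ.ν θ.τ9.M p (gOfRecord₁₃ F N θ.toStage13Params p) 0 s₀ lab ≠ ∅ := by
    rw [← σOfRecord_zero_Ω_one]; exact hΩ
  have hT' : (fun V' : GaugeField (F.P p.K) 1 (SU N) =>
      transportOfRecord F N p.K 0 (fun U =>
        wOfRecord₉ F N θ.toStage9Params p (gOfRecord₁₃ F N θ.toStage13Params p) 0 (σOfRecord F θ.ν θ.τ9.M p (gOfRecord₁₃ F N θ.toStage13Params p) 0 s₀ lab) U V' *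
          rhoZeroOfRecord F N p.K (gOfRecord₁₃ F N θ.toStage13Params p 0) (EOfRecord₁₃ F N θ.toStage13Params p) U) V') ≠ 0 := by
    rw [← slotsTOfRecord₁₃H_one_eq θ p]; exact hT
  obtain ⟨hnew, hanE, hanR, hanB, hid⟩ := hx s₀ lab hΩ' hT'
  refine ⟨fun h10 => absurd h10 (by omega), hnew, hanE, hanR, hanB, Or.inr ?_⟩
  rw [slotsTOfRecord₁₃H_one_eq θ p, sect2Slot_graftAbove_zero (FluctV N), sect2Slot_eq_TkOfRecord_sect2Operand]
  exact hid

/-- **THE CONVERSE: [III] §3's DELIVERABLE AT LEVEL `0` GIVES THE LABELLED FIRST-STEP SUPPLY** (no sign needed).  Instantiate `Sect3SupplyAt θ p 0` at the exposed witness of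
`ρ₀`'s §2 form that def-T's hypothesis-free `sLaw₁₃CoPH_zero` provides; the supplied family `tT` (universal in 𝐄) serves as `u` and `EkT` as `E₁`: at a labelled child
`s = σ s₀ t` with `Ω₁(t) ≠ ∅` the 𝐓-image laws `Sect2.LawsT … 0` contain r11's new-term clauses and the analyticity `LFHypAnalytic … 1` of the level-1 terms, and the 𝐓-image clause,
its zero disjunct excluded by the presence guard, is the transport identity in def-T's letters. [cite: Balaban1988Convergent, Thm 1 p.262, §3 p.279, (3.25) p.270, (2.27)–(2.31) pp.259–260, (2.41)–(2.42) p.261] -/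
theorem firstStepSupplyAtLabels_of_sect3SupplyAt_zero (h : Sect3SupplyAt θ p 0) : FirstStepSupplyAtLabels θ p := by
  obtain ⟨t, Ek, hS⟩ := (sLaw₁₃CoPH_iff F N θ p 0).mp (sLaw₁₃CoPH_zero F N θ p)
  obtain ⟨tT, EkT, huT, -, hx⟩ := h t Ek hS
  refine ⟨tT, EkT, huT, fun s₀ lab hΩ hT => ?_⟩
  have hs : (σOfRecord F θ.ν θ.τ9.M p (gOfRecord₁₃ F N θ.toStage13Params p) 0 s₀ lab).Ω 1 ≠ ∅ := by
    rw [σOfRecord_zero_Ω_one]; exact hΩ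
  obtain ⟨hlaws, hcl⟩ := hx _ hs
  obtain ⟨-, hnew, hA⟩ := hlaws
  refine ⟨hnew, fun X z g hg0 hgγ => hA.analyticE 1 le_rfl le_rfl X z g hg0 hgγ, fun X => hA.analyticR 1 le_rfl le_rfl X,
    fun X a => hA.analyticB 1 le_rfl le_rfl X a, ?_⟩
  rw [slotsTOfRecord₁₃H_one_eq θ p, sect2Slot_eq_TkOfRecord_sect2Operand] at hcl
  exact hcl.resolve_left hT

/-- ★★ **[III] §3's DELIVERABLE AT LEVEL `0` IS EXACTLY THE FIRST-STEP SUPPLY IN PRINT's INDEXING**: `Sect3SupplyAt θ p 0 ↔ FirstStepSupplyAtLabels θ p` (generic `θ`, every run;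
the signs `0 ≤ E₀, B₀` serve the absent-children bookkeeping of the `←` direction only). [cite: Balaban1988Convergent, §3 pp.264–270, (3.5) p.265, (3.25) p.270, Thm 2 p.263; Balaban1987RG1, Thm 1 p.258] -/
theorem sect3SupplyAt_zero_iff_firstStepSupplyAtLabels (hE₀ : 0 ≤ θ.s2.lf.E₀) (hB₀ : 0 ≤ θ.s2.lf.B₀) :
    Sect3SupplyAt θ p 0 ↔ FirstStepSupplyAtLabels θ p :=
  ⟨firstStepSupplyAtLabels_of_sect3SupplyAt_zero θ p, sect3SupplyAt_zero_of_firstStepSupplyAtLabels θ p hE₀ hB₀⟩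

end Equivalence

/-! ## §4. `ρ₁`'s §2 form at the re-pinned door of the cured witness of record from the labelled first-step supply and `0 < K` alone -/

section Faces

variable (F : T4Family) (N : ℕ) [NeZero N]

/-- ★ **`ρ₁`'s §2 FORM AT THE RE-PINNED DOOR OF THE CURED WITNESS OF RECORD, EVERY HISTORY OF LENGTH 1, FROM `FirstStepSupplyAtLabels` AND `0 < K` — NOTHING ELSE**
(dag-n11-e M2 §6 `sLaw₁₃CoPH_one_rePinH_doorCured_theta13LiveOfRecord_of_sect3Supply_zero` over §3; the signs are the family's, `E0∕B0_nonneg_theta13LiveOfFamily`).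
The displayed hypothesis IS the first renormalization step at print's labels. [cite: Balaban1988Convergent, Thm 1 p.262, Theorem p.245, §3 pp.264–270, (3.5) p.265, (3.24)–(3.25) p.270; Balaban1987RG1, Thm 1 p.258; Balaban1989LargeFieldI, (0.3)–(0.4) p.176] -/
theorem sLaw₁₃CoPH_one_rePinH_doorCured_theta13LiveOfRecord_of_firstStepSupplyAtLabels (p : B12.RunParams) (hK : 0 < p.K)
    (h : FirstStepSupplyAtLabels (rePinH (Stage13HParams.ofHistoryBlind F N (Stage13RParams.ofCured F N (theta13LiveOfRecord F N)))) p) :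
    SLaw₁₃CoPH F N (rePinH (Stage13HParams.ofHistoryBlind F N (Stage13RParams.ofCured F N (theta13LiveOfRecord F N)))) p 1 :=
  sLaw₁₃CoPH_one_rePinH_doorCured_theta13LiveOfRecord_of_sect3Supply_zero F N p hK
    (sect3SupplyAt_zero_of_firstStepSupplyAtLabels _ p
      (E0_nonneg_theta13LiveOfFamily F N eps0OfRecord₁₃ (zeta316OfRecord F N (numerics7OfFamily eps0OfRecord₁₃) 1 1) (RzOfRecord F N) (ZtOfRecord F N))
      (B0_nonneg_theta13LiveOfFamily F N eps0OfRecord₁₃ (zeta316OfRecord F N (numerics7OfFamily eps0OfRecord₁₃) 1 1) (RzOfRecord F N) (ZtOfRecord F N)) h)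

end Faces

end Summit.QuantumFields.YangMills.Theorems.BalabanUVNodesN11FirstStepSupplyLabels

end
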